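import Literature.NumberTheory.LFunctions.NicolasChainCheck
import HarnessLib

/-!
# Nicolas's inequality at the primorials `p#`, `p ≤ 360649`, by kernel computation: the certified run
# (discharge of `Literature.NumberTheory.LFunctions.nicolas_iff`, Nicolas 1983, Thm. 2 (a))

Topic: `Literature/NumberTheory/LFunctions`. Pure proof file (a kernel computation; nothing is
asserted, no definition). `run1`, `run2` evaluate `NicolasChain.runDN 15400` — at most `15400` steps of
the Nicolas chain of `NicolasChainCheck.lean` along the prime table `ChainTable.table`, each
certifying the primality of the next entry `p'`, extending the enclosures of `log p'`, `θ(p')` and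
`∏_{q ≤ p'} q/(q−1)`, and performing the comparison `nicolasChk` that yields Nicolas's inequality
`e^γ log log(p'#) < p'#/φ(p'#)` — from the initial state (the prime `2`, `NicolasChain.initN`, the
literal on the left of `run1`) to the prime `168869` (entry `15400` of `table.tail`) and on to the prime
`360649 > 599²` (entry `30800`). The meaning of these states is supplied by `NicolasChain.runDN_sound`
(`NicolasChainSound.lean`: the invariant `Inv` is preserved); the assembly with the analytic range
`p ≥ 599²` (`NicolasLogfUpperRH.lean`) is `NicolasCriterionProofs.lean`. The expected states were
obtained by evaluating the same function compiled. `decide +kernel`, standard axioms only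
(`maxHeartbeats 0` lifts the deterministic time-out for these two declarations).

## References

* J.-L. Nicolas, *Petites valeurs de la fonction d'Euler*, J. Number Theory 17 (1983), 375–388,
  Thm. 2 (a). [Nicolas1983]
-/

namespace Literature.NumberTheory.LFunctions.NicolasChainRun

open NicolasChain

set_option maxHeartbeats 0 in
/-- **Chunk 1 of the certified Nicolas run** (steps `0` to `15400`, primes `2` to `168869`).
[cite: Nicolas1983, Thm. 2 (a)] -/
theorem run1 :
    runDN 15400
      ⟨2, 837963523372001241299075, 837963523372001241347433,
        837963523372001241347433, 2417851639229258349412352⟩ =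
    some ⟨168869, 14551693261091611892557246, 14551693261092087498932709,
        203346320644126591981236948513, 25920139116191774204480740⟩ := by
  decide +kernel

set_option maxHeartbeats 0 in
/-- **Chunk 2 of the certified Nicolas run** (steps `15400` to `30800`, primes `168869` to
`360649 > 599² = 358801`). [cite: Nicolas1983, Thm. 2 (a)] -/
theorem run2 :
    runDN 15400
      ⟨168869, 14551693261091611892557246, 14551693261092087498932709,
        203346320644126591981236948513, 25920139116191774204480740⟩ =
    some ⟨360649, 15469004315349700887174786, 15469004315350176493980174,
        435316248904815008284154965780, 27555502256890831221541507⟩ := by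
  decide +kernel

end Literature.NumberTheory.LFunctions.NicolasChainRun
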